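import Mathlib
import Summits.QuantumFields.YangMills.Theses.ThermalRuler
import Literature.MathematicalPhysics.QuantumLattice.StrongExpDecayLGT

/-!
# Birth skeleton (BC3) for crux `StrongGapSeqAllG` (stmt-QuantumFields-10417) — `Lines/birth.lean`

Registrar: `planner-skel-stmt-QuantumFields-10417-0` (skeleton-register one-shot; route
`route-QuantumFields-ThermalRuler`, re-audit bin REPAIRABLE), 2026-08-17.

Crux (route file `Theses/ThermalRuler.lean`, decl
`Summit.QuantumFields.YangMills.Theses.ThermalRuler.StrongGapSeqAllG`, rank 6, IR input L1 of the
IR-first assembly): every compact simple Lie group `G` has a faithful unitary lattice representation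
`r` and couplings `b_k → ∞` such that at each `b_k` Wilson's four-dimensional theory in `r` has
EXPONENTIAL DECAY OF CORRELATIONS UNDER ARBITRARY BOUNDARY CONDITIONS (Chatterjee 2021, Def. 2.3,
inlined: all cubes `v + [0,M]⁴`, all boundary conditions `η` through `ymSpecification r.ρ (b k) Λ η`,
all measurable edge-local `f, g` bounded by `1`) with prefactor `K₁ = 4` and some rate
`m_k ∈ (0,1]`.

## The cut: WEAK (torus) mixing first, then the boundary — torus gap ∘ (torus ⇒ strong)

The crux conflates two questions that the literature keeps apart (Martinelli–Olivieri 1994; the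
remark after Chatterjee2021 Def. 2.3 that it is unclear whether the mass-gap conjecture includes the
strong version): (i) is there a lattice mass gap in the usual, translation-invariant sense —
volume-uniform exponential clustering on periodic boxes — along some `b_k → ∞`; and (ii) does
torus/bulk clustering survive ADVERSARIAL boundary conditions (weak ⇒ strong mixing; false for
general spin systems in `d ≥ 3`, open for gauge theories, where boundary holonomies inject fluxes
whose screening is confinement physics)?  The skeleton is exactly this factorisation, in the
vocabulary the route already fixed for its crux 4 `TorusToStrong` (stmt-QuantumFields-10415):

* `stub_torusGapSeq` (T — TORUS GAP ALONG A SEQUENCE, EVERY `G`; open, the deepest piece): every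
  compact simple Lie `G` has a faithful `r` and couplings `b_k → ∞`, `b_k ≥ 1`, such that at each
  `b_k` there are `K ≥ 2`, `m > 0` with `|E fg − Ef·Eg| ≤ K e^{−m‖x₁−x₂‖_∞}` for all edge-local
  measurable `f, g` bounded by `1` on EVERY symmetric torus `(ℤ/(2S+1))⁴` (tree `wilsonMeasure`,
  observables pulled back by `torusLift`, edges at torus distance `≤ S`) — verbatim the antecedent
  of `TorusToStrong` at `(r.ρ, b_k, K, m)`.
* `stub_torusToStrongRate` (B — TORUS ⇒ STRONG AT SOME RATE; open, `XL`): for every compact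
  second-countable `G`, continuous unitary `ρ`, `β ≥ 1`, `K ≥ 2`, `m > 0`: the torus clustering
  above at `(ρ, β, K, m)` implies Chatterjee's boundary-uniform decay at `β` with SOME constant
  `K₁` and SOME RATE `K₂ > 0` (inlined exactly as in the crux).  This is the rate-free weakening of
  the route's item `TorusToStrong` (which asserts it with `K₁ = C·K·β`, `K₂ = m/C`, `C = C(G,ρ)`):
  `torusToStrongRate_of_torusToStrong : TorusToStrong → (B)` is proved below, so a proof of item
  stmt-QuantumFields-10415 discharges B (`StrongGapSeqAllG_of_torusToStrong`).
* `StrongGapSeqAllG_of : StrongGapSeqAllG` — the REGISTERED composition, the two stubs BY NAME; a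
  real proof, not a one-line seam: Borel structure and second countability of `G` (closed embedding
  `r.ρ`), B applied at each `b_k` (`strongDecaySeq_of_torusGap`, the pointwise core, proved), and
  the NORMALISATION `(K₁, K₂) ↦ (4, m')`, `m' = min 1 (K₂·log 2 / log max(K₁,4)) ∈ (0,1]`
  (`exists_rate_normalisation`, proved: interpolate the decay bound with the a-priori bound
  `|E fg − Ef·Eg| ≤ 2`, valid because `ymSpecification` is a zero-or-probability kernel), then a
  choice of `m'_k`.  `StrongGapSeqAllG_of_hypotheses : (T) → (B) → StrongGapSeqAllG` is the same
  glue with the two stub STATEMENTS as explicit hypotheses (sorry-free, axioms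
  propext/choice/Quot.sound), and `StrongGapSeqAllG_of_torusToStrong : TorusToStrong →
  StrongGapSeqAllG` records that stub T plus the route's item stmt-QuantumFields-10415 suffice.

Neither stub is the crux or the summit in disguise: T speaks only of periodic boxes (`wilsonMeasure`,
no boundary condition `η`, no `ymSpecification`), B is a conditional at ONE coupling for an
arbitrary compact group (no sequence, no `IsCompactSimpleLieGroup`, no `∃ r`); neither mentions OS
data, schemes or `YangMills`.  BC3 probes (registrar folder `bc/`): `T → StrongGapSeqAllG`,
`T → YangMills`, `B → StrongGapSeqAllG`, `B → YangMills` by `first | exact? | simpa using h | aesop`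
all FAIL — raw outputs in `Lines/birth.md`.

## Disproof used

None exists: `Cruxes/StrongGapSeqAllG/` had no workfiles before this one (no `Disproof.lean`, no
`Theorems/StrongGapSeqAllG/Negative/`); the summit's negatives index (5 entries: RobustYangMillsRG,
MirrorModular DiagonalMirrorRP, AdaptiveCoarseSystem, MultibosonLatticeGap, AdmissibleRootsExist)
has nothing on torus clustering or boundary-uniform decay of 4D pure Yang–Mills, and neither stub
is an instance of any of them.  The refuter evidence on the crux (rattack-10417: with `0 < m k`
deleted the item is a theorem) is respected: both stubs carry strictly positive rates.

`lean check`: rc 0; sorries = 2 = stubs (`stub_torusGapSeq`, `stub_torusToStrongRate`), zero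
elsewhere.  Namespace `Summit.QuantumFields.YangMills.Cruxes.StrongGapSeqAllG.Birth`.
-/

set_option autoImplicit false

noncomputable section

namespace Summit.QuantumFields.YangMills.Cruxes.StrongGapSeqAllG.Birth

open scoped BigOperators Topology Classical MeasureTheory Matrix
open Filter MeasureTheory
open Literature.MathematicalPhysics.QuantumLattice
open Literature.MathematicalPhysics.QuantumFieldTheory (LatticeRep IsCompactSimpleLieGroup)
open Summit.QuantumFields.YangMills.Theses.ThermalRuler

/-! ### The stubs (the ONLY `sorry`s of this file) -/

/-- **Stub T — torus gap along a sequence, every `G` (OPEN; the deepest piece).**  For every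
compact simple Lie group `G` (Borel σ-algebra) there are a faithful unitary lattice representation
`r` and couplings `b_k → ∞` with `b_k ≥ 1` such that at each `b_k` the Wilson theory in `r` clusters
exponentially, UNIFORMLY IN THE VOLUME, on every symmetric torus `(ℤ/(2S+1))⁴`: some `K ≥ 2`,
`m > 0` with `|E fg − Ef·Eg| ≤ K·exp(−m‖x₁ − x₂‖_∞)` for all measurable edge-local `f, g` bounded
by `1` based at edges within torus distance `S` (verbatim the antecedent of the route's
`TorusToStrong` at `(r.ρ, b_k, K, m)`).  The lattice mass gap in its usual translation-invariant
form, at arbitrarily weak coupling, for some faithful `r`; first-order bulk transitions may be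
skipped since only a sequence is asked. -/
theorem stub_torusGapSeq :
    ∀ (G : Type) [Group G] [TopologicalSpace G] [IsTopologicalGroup G] [CompactSpace G], Literature.MathematicalPhysics.QuantumFieldTheory.IsCompactSimpleLieGroup G → letI : MeasurableSpace G := borel G; haveI : BorelSpace G := ⟨rfl⟩; ∃ r : Literature.MathematicalPhysics.QuantumFieldTheory.LatticeRep G, ∃ b : ℕ → ℝ, Filter.Tendsto b Filter.atTop Filter.atTop ∧ ∀ k, 1 ≤ b k ∧ ∃ K m : ℝ, 2 ≤ K ∧ 0 < m ∧ (∀ (S : ℕ) (e₁ e₂ : Literature.MathematicalPhysics.QuantumLattice.ZdEdge 4) (f g : Literature.MathematicalPhysics.QuantumLattice.LGConfig 4 G → ℝ), (∀ j, |e₁.1 j| ≤ S ∧ |e₂.1 j| ≤ S ∧ |e₁.1 j - e₂.1 j| ≤ S) → Measurable f → Measurable g → Literature.MathematicalPhysics.QuantumLattice.IsCylinder f ((Literature.MathematicalPhysics.QuantumLattice.plaquettesTouching {e₁}).biUnion Literature.MathematicalPhysics.QuantumLattice.plaquetteEdges) → Literature.MathematicalPhysics.QuantumLattice.IsCylinder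 g ((Literature.MathematicalPhysics.QuantumLattice.plaquettesTouching {e₂}).biUnion Literature.MathematicalPhysics.QuantumLattice.plaquetteEdges) → (∀ U, |f U| ≤ 1) → (∀ U, |g U| ≤ 1) → |(∫ U, f (Literature.MathematicalPhysics.QuantumLattice.torusLift (2 * S + 1) U) * g (Literature.MathematicalPhysics.QuantumLattice.torusLift (2 * S + 1) U) ∂(Literature.MathematicalPhysics.QuantumFieldTheory.wilsonMeasure (d := 4) (L := 2 * S + 1) r.ρ (b k))) - (∫ U, f (Literature.MathematicalPhysics.QuantumLattice.torusLift (2 * S + 1) U) ∂(Literature.MathematicalPhysics.QuantumFieldTheory.wilsonMeasure (d := 4) (L := 2 * S + 1) r.ρ (b k))) * (∫ U, g (Literature.MathematicalPhysics.QuantumLattice.torusLift (2 * S + 1) U) ∂(Literature.MathematicalPhysics.QuantumFieldTheory.wilsonMeasure (d := 4) (L := 2 * S + 1) r.ρ (b k)))| ≤ K * Real.exp (-(m * ‖e₁.1 - e₂.1‖))) := by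
  sorry

/-- **Stub B — torus clustering ⇒ strong (boundary-uniform) decay at some rate (OPEN; `XL`).**
For every compact second-countable `G`, continuous unitary `ρ : G →* M_n(ℂ)`, `β ≥ 1`, `K ≥ 2`,
`m > 0`: volume-uniform torus clustering at `(ρ, β, K, m)` (as in stub T) implies Chatterjee's
exponential decay of correlations under arbitrary boundary conditions at `β` (Def. 2.3, inlined
exactly as in the crux) with some `K₁` and some rate `K₂ > 0`.  Rate-free weakening of the route's
item `TorusToStrong` (stmt-QuantumFields-10415), see `torusToStrongRate_of_torusToStrong`; the
content is weak ⇒ strong mixing for 4D lattice gauge theories at fixed coupling (screening of the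
fluxes injected by boundary holonomies). -/
theorem stub_torusToStrongRate :
    ∀ (G : Type) [Group G] [TopologicalSpace G] [IsTopologicalGroup G] [CompactSpace G] [SecondCountableTopology G] [MeasurableSpace G] [BorelSpace G] (n : ℕ) (ρ : G →* Matrix (Fin n) (Fin n) ℂ), Continuous ρ → (∀ g, ρ g ∈ Matrix.unitaryGroup (Fin n) ℂ) → ∀ (β K m : ℝ), 1 ≤ β → 2 ≤ K → 0 < m → (∀ (S : ℕ) (e₁ e₂ : Literature.MathematicalPhysics.QuantumLattice.ZdEdge 4) (f g : Literature.MathematicalPhysics.QuantumLattice.LGConfig 4 G → ℝ), (∀ j, |e₁.1 j| ≤ S ∧ |e₂.1 j| ≤ S ∧ |e₁.1 j - e₂.1 j| ≤ S) → Measurable f → Measurable g → Literature.MathematicalPhysics.QuantumLattice.IsCylinder f ((Literature.MathematicalPhysics.QuantumLattice.plaquettesTouching {e₁}).biUnion Literature.MathematicalPhysics.QuantumLattice.plaquetteEdges) → Literature.MathematicalPhysics.QuantumLattice.IsCylinder g ((Literature.MathematicalPhysics.QuantumLattice.plaquettesTouching {e₂}).biUnion Literature.MathematicalPhysics.QuantumLattice.plaquetteEdges)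 → (∀ U, |f U| ≤ 1) → (∀ U, |g U| ≤ 1) → |(∫ U, f (Literature.MathematicalPhysics.QuantumLattice.torusLift (2 * S + 1) U) * g (Literature.MathematicalPhysics.QuantumLattice.torusLift (2 * S + 1) U) ∂(Literature.MathematicalPhysics.QuantumFieldTheory.wilsonMeasure (d := 4) (L := 2 * S + 1) ρ β)) - (∫ U, f (Literature.MathematicalPhysics.QuantumLattice.torusLift (2 * S + 1) U) ∂(Literature.MathematicalPhysics.QuantumFieldTheory.wilsonMeasure (d := 4) (L := 2 * S + 1) ρ β)) * (∫ U, g (Literature.MathematicalPhysics.QuantumLattice.torusLift (2 * S + 1) U) ∂(Literature.MathematicalPhysics.QuantumFieldTheory.wilsonMeasure (d := 4) (L := 2 * S + 1) ρ β))| ≤ K * Real.exp (-(m * ‖e₁.1 - e₂.1‖))) → ∃ K₁ K₂ : ℝ, 0 < K₂ ∧ (∀ (M : ℕ) (v : Fin 4 → ℤ) (Λ : Finset (Literature.MathematicalPhysics.QuantumLattice.ZdEdge 4)) (η : Literature.MathematicalPhysics.QuantumLattice.LGConfig 4 G) (e₁ e₂ : Literature.MathematicalPhysics.QuantumLattice.ZdEdge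 4) (f g : Literature.MathematicalPhysics.QuantumLattice.LGConfig 4 G → ℝ), Λ = (((Fintype.piFinset fun j : Fin 4 => Finset.Icc (v j) (v j + M)) ×ˢ (Finset.univ : Finset (Fin 4))).filter fun e => e.1 e.2 + 1 ≤ v e.2 + M ∧ ∀ j, j ≠ e.2 → v j < e.1 j ∧ e.1 j < v j + M) → (∀ j, v j ≤ e₁.1 j ∧ e₁.1 j ≤ v j + M) → e₁.1 e₁.2 + 1 ≤ v e₁.2 + M → (∀ j, v j ≤ e₂.1 j ∧ e₂.1 j ≤ v j + M) → e₂.1 e₂.2 + 1 ≤ v e₂.2 + M → Measurable f → Measurable g → Literature.MathematicalPhysics.QuantumLattice.IsCylinder f ((Literature.MathematicalPhysics.QuantumLattice.plaquettesTouching {e₁}).biUnion Literature.MathematicalPhysics.QuantumLattice.plaquetteEdges) → Literature.MathematicalPhysics.QuantumLattice.IsCylinder g ((Literature.MathematicalPhysics.QuantumLattice.plaquettesTouching {e₂}).biUnion Literature.MathematicalPhysics.QuantumLattice.plaquetteEdges) → (∀ U, |f U| ≤ 1) → (∀ U, |g U| ≤ 1) → |(∫ U, f U * g U ∂(Literature.MathematicalPhysics.QuantumLattice.ymSpecification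 (d := 4) ρ β Λ η)) - (∫ U, f U ∂(Literature.MathematicalPhysics.QuantumLattice.ymSpecification (d := 4) ρ β Λ η)) * (∫ U, g U ∂(Literature.MathematicalPhysics.QuantumLattice.ymSpecification (d := 4) ρ β Λ η))| ≤ K₁ * Real.exp (-(K₂ * ‖e₁.1 - e₂.1‖))) := by
  sorry

/-! ### Proved glue -/

/-- The route's own crux 4 `TorusToStrong` (stmt-QuantumFields-10415: constants `K₁ = C·K·β`,
`K₂ = m/C`) implies the statement of stub B outright. [glue] -/
theorem torusToStrongRate_of_torusToStrong (h : TorusToStrong) :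
    ∀ (G : Type) [Group G] [TopologicalSpace G] [IsTopologicalGroup G] [CompactSpace G] [SecondCountableTopology G] [MeasurableSpace G] [BorelSpace G] (n : ℕ) (ρ : G →* Matrix (Fin n) (Fin n) ℂ), Continuous ρ → (∀ g, ρ g ∈ Matrix.unitaryGroup (Fin n) ℂ) → ∀ (β K m : ℝ), 1 ≤ β → 2 ≤ K → 0 < m → (∀ (S : ℕ) (e₁ e₂ : Literature.MathematicalPhysics.QuantumLattice.ZdEdge 4) (f g : Literature.MathematicalPhysics.QuantumLattice.LGConfig 4 G → ℝ), (∀ j, |e₁.1 j| ≤ S ∧ |e₂.1 j| ≤ S ∧ |e₁.1 j - e₂.1 j| ≤ S) → Measurable f → Measurable g → Literature.MathematicalPhysics.QuantumLattice.IsCylinder f ((Literature.MathematicalPhysics.QuantumLattice.plaquettesTouching {e₁}).biUnion Literature.MathematicalPhysics.QuantumLattice.plaquetteEdges) → Literature.MathematicalPhysics.QuantumLattice.IsCylinder g ((Literature.MathematicalPhysics.QuantumLattice.plaquettesTouching {e₂}).biUnion Literature.MathematicalPhysics.QuantumLattice.plaquetteEdges) → (∀ U, |f U| ≤ 1) → (∀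 U, |g U| ≤ 1) → |(∫ U, f (Literature.MathematicalPhysics.QuantumLattice.torusLift (2 * S + 1) U) * g (Literature.MathematicalPhysics.QuantumLattice.torusLift (2 * S + 1) U) ∂(Literature.MathematicalPhysics.QuantumFieldTheory.wilsonMeasure (d := 4) (L := 2 * S + 1) ρ β)) - (∫ U, f (Literature.MathematicalPhysics.QuantumLattice.torusLift (2 * S + 1) U) ∂(Literature.MathematicalPhysics.QuantumFieldTheory.wilsonMeasure (d := 4) (L := 2 * S + 1) ρ β)) * (∫ U, g (Literature.MathematicalPhysics.QuantumLattice.torusLift (2 * S + 1) U) ∂(Literature.MathematicalPhysics.QuantumFieldTheory.wilsonMeasure (d := 4) (L := 2 * S + 1) ρ β))| ≤ K * Real.exp (-(m * ‖e₁.1 - e₂.1‖))) → ∃ K₁ K₂ : ℝ, 0 < K₂ ∧ (∀ (M : ℕ) (v : Fin 4 → ℤ) (Λ : Finset (Literature.MathematicalPhysics.QuantumLattice.ZdEdge 4)) (η : Literature.MathematicalPhysics.QuantumLattice.LGConfig 4 G) (e₁ e₂ : Literature.MathematicalPhysics.QuantumLattice.ZdEdge 4) (f g : Literature.MathematicalPhysics.QuantumLattice.LGConfig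 4 G → ℝ), Λ = (((Fintype.piFinset fun j : Fin 4 => Finset.Icc (v j) (v j + M)) ×ˢ (Finset.univ : Finset (Fin 4))).filter fun e => e.1 e.2 + 1 ≤ v e.2 + M ∧ ∀ j, j ≠ e.2 → v j < e.1 j ∧ e.1 j < v j + M) → (∀ j, v j ≤ e₁.1 j ∧ e₁.1 j ≤ v j + M) → e₁.1 e₁.2 + 1 ≤ v e₁.2 + M → (∀ j, v j ≤ e₂.1 j ∧ e₂.1 j ≤ v j + M) → e₂.1 e₂.2 + 1 ≤ v e₂.2 + M → Measurable f → Measurable g → Literature.MathematicalPhysics.QuantumLattice.IsCylinder f ((Literature.MathematicalPhysics.QuantumLattice.plaquettesTouching {e₁}).biUnion Literature.MathematicalPhysics.QuantumLattice.plaquetteEdges) → Literature.MathematicalPhysics.QuantumLattice.IsCylinder g ((Literature.MathematicalPhysics.QuantumLattice.plaquettesTouching {e₂}).biUnion Literature.MathematicalPhysics.QuantumLattice.plaquetteEdges) → (∀ U, |f U| ≤ 1) → (∀ U, |g U| ≤ 1) → |(∫ U, f U * g U ∂(Literature.MathematicalPhysics.QuantumLattice.ymSpecification (d := 4) ρ β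 Λ η)) - (∫ U, f U ∂(Literature.MathematicalPhysics.QuantumLattice.ymSpecification (d := 4) ρ β Λ η)) * (∫ U, g U ∂(Literature.MathematicalPhysics.QuantumLattice.ymSpecification (d := 4) ρ β Λ η))| ≤ K₁ * Real.exp (-(K₂ * ‖e₁.1 - e₂.1‖))) := by
  intro G _ _ _ _ _ _ _ n ρ hρ hu β K m hβ hK hm ht
  obtain ⟨C, hC, H⟩ := h G n ρ hρ hu
  exact ⟨C * K * β, m / C, div_pos hm hC, H β K m hβ hK hm ht⟩

/-- **Rate normalisation** (real analysis, proved): given a rate `K₂ > 0` and any prefactor `K₁`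
there is `m ∈ (0,1]` — namely `m = min 1 (K₂ · log 2 / log (max K₁ 4))` — such that every quantity
`c` with the a-priori bound `|c| ≤ 2` and the decay bound `|c| ≤ K₁ e^{−K₂ D}` (`D ≥ 0`) satisfies
`|c| ≤ 4 e^{−m D}`.  (Far regime `K₂D ≥ log(A/2)`: compare exponents; near regime: `mD ≤ log 2`.)
[folklore] -/
theorem exists_rate_normalisation (K₁ : ℝ) {K₂ : ℝ} (hK₂ : 0 < K₂) :
    ∃ m : ℝ, 0 < m ∧ m ≤ 1 ∧ ∀ c D : ℝ, 0 ≤ D → |c| ≤ 2 →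
      |c| ≤ K₁ * Real.exp (-(K₂ * D)) → |c| ≤ 4 * Real.exp (-(m * D)) := by
  set A : ℝ := max K₁ 4 with hA_def
  have hA4 : (4 : ℝ) ≤ A := le_max_right _ _
  have hA0 : 0 < A := by linarith
  have hK₁A : K₁ ≤ A := le_max_left _ _
  have hlog2 : 0 < Real.log 2 := Real.log_pos (by norm_num)
  have hlog4 : Real.log 4 = 2 * Real.log 2 := by
    rw [show (4 : ℝ) = 2 ^ 2 by norm_num, Real.log_pow]; norm_num
  have hlogA4 : Real.log 4 ≤ Real.log A := Real.log_le_log (by norm_num) hA4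
  have hlogA0 : 0 < Real.log A := by linarith
  have hθA : Real.log 2 / Real.log A * Real.log A = Real.log 2 := div_mul_cancel₀ _ hlogA0.ne'
  have hθ0 : 0 < Real.log 2 / Real.log A := div_pos hlog2 hlogA0
  have hθ1 : Real.log 2 / Real.log A ≤ 1 := by
    rw [div_le_one hlogA0]; linarith
  set θ : ℝ := Real.log 2 / Real.log A with hθ_def
  refine ⟨min 1 (K₂ * θ), lt_min one_pos (mul_pos hK₂ hθ0), min_le_left _ _, ?_⟩
  intro c D hD hc2 hcK
  have hmθ : min 1 (K₂ * θ) * D ≤ K₂ * θ * D :=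
    mul_le_mul_of_nonneg_right (min_le_right _ _) hD
  have hθlog2 : 0 ≤ θ * Real.log 2 := mul_nonneg hθ0.le hlog2.le
  have hcA : |c| ≤ A * Real.exp (-(K₂ * D)) :=
    hcK.trans (mul_le_mul_of_nonneg_right hK₁A (Real.exp_pos _).le)
  by_cases hfar : Real.log A - Real.log 2 ≤ K₂ * D
  · -- far regime: compare exponents
    refine hcA.trans ?_
    have h1 : A * Real.exp (-(K₂ * D)) = Real.exp (Real.log A - K₂ * D) := by
      rw [Real.exp_sub, Real.exp_log hA0, Real.exp_neg, div_eq_mul_inv]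
    have h2 : (4 : ℝ) * Real.exp (-(min 1 (K₂ * θ) * D)) =
        Real.exp (Real.log 4 - min 1 (K₂ * θ) * D) := by
      rw [Real.exp_sub, Real.exp_log (by norm_num : (0 : ℝ) < 4), Real.exp_neg, div_eq_mul_inv]
    rw [h1, h2, Real.exp_le_exp]
    have hprod : (1 - θ) * (Real.log A - Real.log 2) ≤ (1 - θ) * (K₂ * D) :=
      mul_le_mul_of_nonneg_left hfar (sub_nonneg.2 hθ1)
    nlinarith [hprod, hθA, hmθ, hlog4, hθlog2]
  · -- near regime: the a-priori bound
    rw [not_le] at hfar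
    refine hc2.trans ?_
    have hKD : θ * (K₂ * D) ≤ θ * (Real.log A - Real.log 2) :=
      mul_le_mul_of_nonneg_left hfar.le hθ0.le
    have h3 : min 1 (K₂ * θ) * D ≤ Real.log 2 := by nlinarith [hKD, hθA, hmθ, hθlog2]
    have h4 : (2 : ℝ) = 4 * Real.exp (-Real.log 2) := by
      rw [Real.exp_neg, Real.exp_log two_pos]; norm_num
    rw [h4]
    refine mul_le_mul_of_nonneg_left ?_ (by norm_num : (0 : ℝ) ≤ 4)
    rw [Real.exp_le_exp]
    linarith

/-! ### The composition -/

/-- **Pointwise core (proved).**  For a compact group `G` with a Borel structure, second countable,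
a lattice representation `r` and couplings `b_k ≥ 1` carrying volume-uniform torus clustering with
constants `(K_k ≥ 2, m_k > 0)` (the body of stub T), the torus ⇒ strong bridge (the statement of
stub B) yields boundary-uniform decay at each `b_k` with the crux's normalisation: prefactor `4`,
rates `m'_k ∈ (0,1]` (via `exists_rate_normalisation` and the a-priori covariance bound under the
zero-or-probability kernel `ymSpecification`). -/
theorem strongDecaySeq_of_torusGap {G : Type} [Group G] [TopologicalSpace G] [IsTopologicalGroup G]
    [CompactSpace G] [SecondCountableTopology G] [MeasurableSpace G] [BorelSpace G]
    (r : Literature.MathematicalPhysics.QuantumFieldTheory.LatticeRep G) (b : ℕ → ℝ)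
    (hk : ∀ k, 1 ≤ b k ∧ ∃ K m : ℝ, 2 ≤ K ∧ 0 < m ∧ (∀ (S : ℕ) (e₁ e₂ : Literature.MathematicalPhysics.QuantumLattice.ZdEdge 4) (f g : Literature.MathematicalPhysics.QuantumLattice.LGConfig 4 G → ℝ), (∀ j, |e₁.1 j| ≤ S ∧ |e₂.1 j| ≤ S ∧ |e₁.1 j - e₂.1 j| ≤ S) → Measurable f → Measurable g → Literature.MathematicalPhysics.QuantumLattice.IsCylinder f ((Literature.MathematicalPhysics.QuantumLattice.plaquettesTouching {e₁}).biUnion Literature.MathematicalPhysics.QuantumLattice.plaquetteEdges) → Literature.MathematicalPhysics.QuantumLattice.IsCylinder g ((Literature.MathematicalPhysics.QuantumLattice.plaquettesTouching {e₂}).biUnion Literature.MathematicalPhysics.QuantumLattice.plaquetteEdges) → (∀ U, |f U| ≤ 1) → (∀ U, |g U| ≤ 1) → |(∫ U, f (Literature.MathematicalPhysics.QuantumLattice.torusLift (2 * S + 1) U) * g (Literature.MathematicalPhysics.QuantumLattice.torusLift (2 * S + 1) U) ∂(Literature.MathematicalPhysics.QuantumFieldTheory.wilsonMeasure (d := 4)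 (L := 2 * S + 1) r.ρ (b k))) - (∫ U, f (Literature.MathematicalPhysics.QuantumLattice.torusLift (2 * S + 1) U) ∂(Literature.MathematicalPhysics.QuantumFieldTheory.wilsonMeasure (d := 4) (L := 2 * S + 1) r.ρ (b k))) * (∫ U, g (Literature.MathematicalPhysics.QuantumLattice.torusLift (2 * S + 1) U) ∂(Literature.MathematicalPhysics.QuantumFieldTheory.wilsonMeasure (d := 4) (L := 2 * S + 1) r.ρ (b k)))| ≤ K * Real.exp (-(m * ‖e₁.1 - e₂.1‖))))
    (hB : ∀ (G : Type) [Group G] [TopologicalSpace G] [IsTopologicalGroup G] [CompactSpace G] [SecondCountableTopology G] [MeasurableSpace G] [BorelSpace G] (n : ℕ) (ρ : G →* Matrix (Fin n) (Fin n) ℂ), Continuous ρ → (∀ g, ρ g ∈ Matrix.unitaryGroup (Fin n) ℂ) → ∀ (β K m : ℝ), 1 ≤ β → 2 ≤ K → 0 < m → (∀ (S : ℕ) (e₁ e₂ : Literature.MathematicalPhysics.QuantumLattice.ZdEdge 4) (f g : Literature.MathematicalPhysics.QuantumLattice.LGConfig 4 G → ℝ), (∀ j, |e₁.1 j| ≤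 S ∧ |e₂.1 j| ≤ S ∧ |e₁.1 j - e₂.1 j| ≤ S) → Measurable f → Measurable g → Literature.MathematicalPhysics.QuantumLattice.IsCylinder f ((Literature.MathematicalPhysics.QuantumLattice.plaquettesTouching {e₁}).biUnion Literature.MathematicalPhysics.QuantumLattice.plaquetteEdges) → Literature.MathematicalPhysics.QuantumLattice.IsCylinder g ((Literature.MathematicalPhysics.QuantumLattice.plaquettesTouching {e₂}).biUnion Literature.MathematicalPhysics.QuantumLattice.plaquetteEdges) → (∀ U, |f U| ≤ 1) → (∀ U, |g U| ≤ 1) → |(∫ U, f (Literature.MathematicalPhysics.QuantumLattice.torusLift (2 * S + 1) U) * g (Literature.MathematicalPhysics.QuantumLattice.torusLift (2 * S + 1) U) ∂(Literature.MathematicalPhysics.QuantumFieldTheory.wilsonMeasure (d := 4) (L := 2 * S + 1) ρ β)) - (∫ U, f (Literature.MathematicalPhysics.QuantumLattice.torusLift (2 * S + 1) U) ∂(Literature.MathematicalPhysics.QuantumFieldTheory.wilsonMeasure (d := 4) (L := 2 * S + 1) ρ β)) * (∫ U, g (Literature.MathematicalPhysics.QuantumLattice.torusLift (2 * S + 1)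 U) ∂(Literature.MathematicalPhysics.QuantumFieldTheory.wilsonMeasure (d := 4) (L := 2 * S + 1) ρ β))| ≤ K * Real.exp (-(m * ‖e₁.1 - e₂.1‖))) → ∃ K₁ K₂ : ℝ, 0 < K₂ ∧ (∀ (M : ℕ) (v : Fin 4 → ℤ) (Λ : Finset (Literature.MathematicalPhysics.QuantumLattice.ZdEdge 4)) (η : Literature.MathematicalPhysics.QuantumLattice.LGConfig 4 G) (e₁ e₂ : Literature.MathematicalPhysics.QuantumLattice.ZdEdge 4) (f g : Literature.MathematicalPhysics.QuantumLattice.LGConfig 4 G → ℝ), Λ = (((Fintype.piFinset fun j : Fin 4 => Finset.Icc (v j) (v j + M)) ×ˢ (Finset.univ : Finset (Fin 4))).filter fun e => e.1 e.2 + 1 ≤ v e.2 + M ∧ ∀ j, j ≠ e.2 → v j < e.1 j ∧ e.1 j < v j + M) → (∀ j, v j ≤ e₁.1 j ∧ e₁.1 j ≤ v j + M) → e₁.1 e₁.2 + 1 ≤ v e₁.2 + M → (∀ j, v j ≤ e₂.1 j ∧ e₂.1 j ≤ v j + M) → e₂.1 e₂.2 + 1 ≤ v e₂.2 + M → Measurable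 f → Measurable g → Literature.MathematicalPhysics.QuantumLattice.IsCylinder f ((Literature.MathematicalPhysics.QuantumLattice.plaquettesTouching {e₁}).biUnion Literature.MathematicalPhysics.QuantumLattice.plaquetteEdges) → Literature.MathematicalPhysics.QuantumLattice.IsCylinder g ((Literature.MathematicalPhysics.QuantumLattice.plaquettesTouching {e₂}).biUnion Literature.MathematicalPhysics.QuantumLattice.plaquetteEdges) → (∀ U, |f U| ≤ 1) → (∀ U, |g U| ≤ 1) → |(∫ U, f U * g U ∂(Literature.MathematicalPhysics.QuantumLattice.ymSpecification (d := 4) ρ β Λ η)) - (∫ U, f U ∂(Literature.MathematicalPhysics.QuantumLattice.ymSpecification (d := 4) ρ β Λ η)) * (∫ U, g U ∂(Literature.MathematicalPhysics.QuantumLattice.ymSpecification (d := 4) ρ β Λ η))| ≤ K₁ * Real.exp (-(K₂ * ‖e₁.1 - e₂.1‖)))) :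
    ∃ m : ℕ → ℝ, ∀ k, 0 < m k ∧ m k ≤ 1 ∧ (∀ (M : ℕ) (v : Fin 4 → ℤ) (Λ : Finset (Literature.MathematicalPhysics.QuantumLattice.ZdEdge 4)) (η : Literature.MathematicalPhysics.QuantumLattice.LGConfig 4 G) (e₁ e₂ : Literature.MathematicalPhysics.QuantumLattice.ZdEdge 4) (f g : Literature.MathematicalPhysics.QuantumLattice.LGConfig 4 G → ℝ), Λ = (((Fintype.piFinset fun j : Fin 4 => Finset.Icc (v j) (v j + M)) ×ˢ (Finset.univ : Finset (Fin 4))).filter fun e => e.1 e.2 + 1 ≤ v e.2 + M ∧ ∀ j, j ≠ e.2 → v j < e.1 j ∧ e.1 j < v j + M) → (∀ j, v j ≤ e₁.1 j ∧ e₁.1 j ≤ v j + M) → e₁.1 e₁.2 + 1 ≤ v e₁.2 + M → (∀ j, v j ≤ e₂.1 j ∧ e₂.1 j ≤ v j + M) → e₂.1 e₂.2 + 1 ≤ v e₂.2 + M → Measurable f → Measurable g → Literature.MathematicalPhysics.QuantumLattice.IsCylinder f ((Literature.MathematicalPhysics.QuantumLattice.plaquettesTouching {e₁}).biUnion Literature.MathematicalPhysics.QuantumLattice.plaquetteEdges)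 → Literature.MathematicalPhysics.QuantumLattice.IsCylinder g ((Literature.MathematicalPhysics.QuantumLattice.plaquettesTouching {e₂}).biUnion Literature.MathematicalPhysics.QuantumLattice.plaquetteEdges) → (∀ U, |f U| ≤ 1) → (∀ U, |g U| ≤ 1) → |(∫ U, f U * g U ∂(Literature.MathematicalPhysics.QuantumLattice.ymSpecification (d := 4) r.ρ (b k) Λ η)) - (∫ U, f U ∂(Literature.MathematicalPhysics.QuantumLattice.ymSpecification (d := 4) r.ρ (b k) Λ η)) * (∫ U, g U ∂(Literature.MathematicalPhysics.QuantumLattice.ymSpecification (d := 4) r.ρ (b k) Λ η))| ≤ 4 * Real.exp (-((m k) * ‖e₁.1 - e₂.1‖))) := by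
  have hkey : ∀ k : ℕ, ∃ m' : ℝ, 0 < m' ∧ m' ≤ 1 ∧ (∀ (M : ℕ) (v : Fin 4 → ℤ) (Λ : Finset (Literature.MathematicalPhysics.QuantumLattice.ZdEdge 4)) (η : Literature.MathematicalPhysics.QuantumLattice.LGConfig 4 G) (e₁ e₂ : Literature.MathematicalPhysics.QuantumLattice.ZdEdge 4) (f g : Literature.MathematicalPhysics.QuantumLattice.LGConfig 4 G → ℝ), Λ = (((Fintype.piFinset fun j : Fin 4 => Finset.Icc (v j) (v j + M)) ×ˢ (Finset.univ : Finset (Fin 4))).filter fun e => e.1 e.2 + 1 ≤ v e.2 + M ∧ ∀ j, j ≠ e.2 → v j < e.1 j ∧ e.1 j < v j + M) → (∀ j, v j ≤ e₁.1 j ∧ e₁.1 j ≤ v j + M) → e₁.1 e₁.2 + 1 ≤ v e₁.2 + M → (∀ j, v j ≤ e₂.1 j ∧ e₂.1 j ≤ v j + M) → e₂.1 e₂.2 + 1 ≤ v e₂.2 + M → Measurable f → Measurable g → Literature.MathematicalPhysics.QuantumLattice.IsCylinder f ((Literature.MathematicalPhysics.QuantumLattice.plaquettesTouching {e₁}).biUnion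 Literature.MathematicalPhysics.QuantumLattice.plaquetteEdges) → Literature.MathematicalPhysics.QuantumLattice.IsCylinder g ((Literature.MathematicalPhysics.QuantumLattice.plaquettesTouching {e₂}).biUnion Literature.MathematicalPhysics.QuantumLattice.plaquetteEdges) → (∀ U, |f U| ≤ 1) → (∀ U, |g U| ≤ 1) → |(∫ U, f U * g U ∂(Literature.MathematicalPhysics.QuantumLattice.ymSpecification (d := 4) r.ρ (b k) Λ η)) - (∫ U, f U ∂(Literature.MathematicalPhysics.QuantumLattice.ymSpecification (d := 4) r.ρ (b k) Λ η)) * (∫ U, g U ∂(Literature.MathematicalPhysics.QuantumLattice.ymSpecification (d := 4) r.ρ (b k) Λ η))| ≤ 4 * Real.exp (-(m' * ‖e₁.1 - e₂.1‖))) := by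
    intro k
    obtain ⟨hb1, K, m, hK, hm, htor⟩ := hk k
    obtain ⟨K₁, K₂, hK₂, hdec⟩ :=
      hB G r.N r.ρ r.continuous r.mem_unitary (b k) K m hb1 hK hm htor
    obtain ⟨m', hm'0, hm'1, hnorm⟩ := exists_rate_normalisation K₁ hK₂
    refine ⟨m', hm'0, hm'1, ?_⟩
    intro M v Λ η e₁ e₂ f g hΛ he₁ he₁' he₂ he₂' hf hg hfc hgc hfb hgb
    exact hnorm _ _ (norm_nonneg _) (abs_integral_mul_sub_mul_integral_le_two hfb hgb)
      (hdec M v Λ η e₁ e₂ f g hΛ he₁ he₁' he₂ he₂' hf hg hfc hgc hfb hgb)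
  choose m' hm' using hkey
  exact ⟨m', hm'⟩

/-- **REGISTERED COMPOSITION — the two stubs BY NAME give the crux BY NAME.**  Fix a compact simple
Lie `G` with its Borel σ-algebra; `stub_torusGapSeq` gives `r`, `b` and the torus constants; `G`
is second countable through the closed embedding `r.ρ`; `strongDecaySeq_of_torusGap` with
`stub_torusToStrongRate` gives the normalised boundary-uniform decay along `b`. -/
theorem StrongGapSeqAllG_of : StrongGapSeqAllG := by
  intro G _ _ _ _ hG
  letI : MeasurableSpace G := borel G
  haveI : BorelSpace G := ⟨rfl⟩
  obtain ⟨r, b, hb, hk⟩ := stub_torusGapSeq G hG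
  haveI : SecondCountableTopology G :=
    (r.continuous.isClosedEmbedding r.injective).isEmbedding.secondCountableTopology
  obtain ⟨m, hm⟩ := strongDecaySeq_of_torusGap r b hk stub_torusToStrongRate
  exact ⟨r, b, m, hb, hm⟩

/-- **The same glue with the stub STATEMENTS as explicit hypotheses** (`(T) → (B) → crux`; no
reference to the stubs; `sorry`-free). -/
theorem StrongGapSeqAllG_of_hypotheses
    (hT : ∀ (G : Type) [Group G] [TopologicalSpace G] [IsTopologicalGroup G] [CompactSpace G], Literature.MathematicalPhysics.QuantumFieldTheory.IsCompactSimpleLieGroup G → letI : MeasurableSpace G := borel G; haveI : BorelSpace G := ⟨rfl⟩; ∃ r : Literature.MathematicalPhysics.QuantumFieldTheory.LatticeRep G, ∃ b : ℕ → ℝ, Filter.Tendsto b Filter.atTop Filter.atTop ∧ ∀ k, 1 ≤ b k ∧ ∃ K m : ℝ, 2 ≤ K ∧ 0 < m ∧ (∀ (S : ℕ) (e₁ e₂ : Literature.MathematicalPhysics.QuantumLattice.ZdEdge 4) (f g : Literature.MathematicalPhysics.QuantumLattice.LGConfig 4 G → ℝ), (∀ j, |e₁.1 j| ≤ S ∧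 |e₂.1 j| ≤ S ∧ |e₁.1 j - e₂.1 j| ≤ S) → Measurable f → Measurable g → Literature.MathematicalPhysics.QuantumLattice.IsCylinder f ((Literature.MathematicalPhysics.QuantumLattice.plaquettesTouching {e₁}).biUnion Literature.MathematicalPhysics.QuantumLattice.plaquetteEdges) → Literature.MathematicalPhysics.QuantumLattice.IsCylinder g ((Literature.MathematicalPhysics.QuantumLattice.plaquettesTouching {e₂}).biUnion Literature.MathematicalPhysics.QuantumLattice.plaquetteEdges) → (∀ U, |f U| ≤ 1) → (∀ U, |g U| ≤ 1) → |(∫ U, f (Literature.MathematicalPhysics.QuantumLattice.torusLift (2 * S + 1) U) * g (Literature.MathematicalPhysics.QuantumLattice.torusLift (2 * S + 1) U) ∂(Literature.MathematicalPhysics.QuantumFieldTheory.wilsonMeasure (d := 4) (L := 2 * S + 1) r.ρ (b k))) - (∫ U, f (Literature.MathematicalPhysics.QuantumLattice.torusLift (2 * S + 1) U) ∂(Literature.MathematicalPhysics.QuantumFieldTheory.wilsonMeasure (d := 4) (L := 2 * S + 1) r.ρ (b k))) * (∫ U, g (Literature.MathematicalPhysics.QuantumLattice.torusLift (2 * S +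 1) U) ∂(Literature.MathematicalPhysics.QuantumFieldTheory.wilsonMeasure (d := 4) (L := 2 * S + 1) r.ρ (b k)))| ≤ K * Real.exp (-(m * ‖e₁.1 - e₂.1‖))))
    (hB : ∀ (G : Type) [Group G] [TopologicalSpace G] [IsTopologicalGroup G] [CompactSpace G] [SecondCountableTopology G] [MeasurableSpace G] [BorelSpace G] (n : ℕ) (ρ : G →* Matrix (Fin n) (Fin n) ℂ), Continuous ρ → (∀ g, ρ g ∈ Matrix.unitaryGroup (Fin n) ℂ) → ∀ (β K m : ℝ), 1 ≤ β → 2 ≤ K → 0 < m → (∀ (S : ℕ) (e₁ e₂ : Literature.MathematicalPhysics.QuantumLattice.ZdEdge 4) (f g : Literature.MathematicalPhysics.QuantumLattice.LGConfig 4 G → ℝ), (∀ j, |e₁.1 j| ≤ S ∧ |e₂.1 j| ≤ S ∧ |e₁.1 j - e₂.1 j| ≤ S) → Measurable f → Measurable g → Literature.MathematicalPhysics.QuantumLattice.IsCylinder f ((Literature.MathematicalPhysics.QuantumLattice.plaquettesTouching {e₁}).biUnion Literature.MathematicalPhysics.QuantumLattice.plaquetteEdges) → Literature.MathematicalPhysics.QuantumLattice.IsCylinder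 g ((Literature.MathematicalPhysics.QuantumLattice.plaquettesTouching {e₂}).biUnion Literature.MathematicalPhysics.QuantumLattice.plaquetteEdges) → (∀ U, |f U| ≤ 1) → (∀ U, |g U| ≤ 1) → |(∫ U, f (Literature.MathematicalPhysics.QuantumLattice.torusLift (2 * S + 1) U) * g (Literature.MathematicalPhysics.QuantumLattice.torusLift (2 * S + 1) U) ∂(Literature.MathematicalPhysics.QuantumFieldTheory.wilsonMeasure (d := 4) (L := 2 * S + 1) ρ β)) - (∫ U, f (Literature.MathematicalPhysics.QuantumLattice.torusLift (2 * S + 1) U) ∂(Literature.MathematicalPhysics.QuantumFieldTheory.wilsonMeasure (d := 4) (L := 2 * S + 1) ρ β)) * (∫ U, g (Literature.MathematicalPhysics.QuantumLattice.torusLift (2 * S + 1) U) ∂(Literature.MathematicalPhysics.QuantumFieldTheory.wilsonMeasure (d := 4) (L := 2 * S + 1) ρ β))| ≤ K * Real.exp (-(m * ‖e₁.1 - e₂.1‖))) → ∃ K₁ K₂ : ℝ, 0 < K₂ ∧ (∀ (M : ℕ) (v : Fin 4 → ℤ) (Λ : Finset (Literature.MathematicalPhysics.QuantumLattice.ZdEdge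 4)) (η : Literature.MathematicalPhysics.QuantumLattice.LGConfig 4 G) (e₁ e₂ : Literature.MathematicalPhysics.QuantumLattice.ZdEdge 4) (f g : Literature.MathematicalPhysics.QuantumLattice.LGConfig 4 G → ℝ), Λ = (((Fintype.piFinset fun j : Fin 4 => Finset.Icc (v j) (v j + M)) ×ˢ (Finset.univ : Finset (Fin 4))).filter fun e => e.1 e.2 + 1 ≤ v e.2 + M ∧ ∀ j, j ≠ e.2 → v j < e.1 j ∧ e.1 j < v j + M) → (∀ j, v j ≤ e₁.1 j ∧ e₁.1 j ≤ v j + M) → e₁.1 e₁.2 + 1 ≤ v e₁.2 + M → (∀ j, v j ≤ e₂.1 j ∧ e₂.1 j ≤ v j + M) → e₂.1 e₂.2 + 1 ≤ v e₂.2 + M → Measurable f → Measurable g → Literature.MathematicalPhysics.QuantumLattice.IsCylinder f ((Literature.MathematicalPhysics.QuantumLattice.plaquettesTouching {e₁}).biUnion Literature.MathematicalPhysics.QuantumLattice.plaquetteEdges) → Literature.MathematicalPhysics.QuantumLattice.IsCylinder g ((Literature.MathematicalPhysics.QuantumLattice.plaquettesTouching {e₂}).biUnion Literature.MathematicalPhysics.QuantumLattice.plaquetteEdges)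 → (∀ U, |f U| ≤ 1) → (∀ U, |g U| ≤ 1) → |(∫ U, f U * g U ∂(Literature.MathematicalPhysics.QuantumLattice.ymSpecification (d := 4) ρ β Λ η)) - (∫ U, f U ∂(Literature.MathematicalPhysics.QuantumLattice.ymSpecification (d := 4) ρ β Λ η)) * (∫ U, g U ∂(Literature.MathematicalPhysics.QuantumLattice.ymSpecification (d := 4) ρ β Λ η))| ≤ K₁ * Real.exp (-(K₂ * ‖e₁.1 - e₂.1‖)))) :
    StrongGapSeqAllG := by
  intro G _ _ _ _ hG
  letI : MeasurableSpace G := borel G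
  haveI : BorelSpace G := ⟨rfl⟩
  obtain ⟨r, b, hb, hk⟩ := hT G hG
  haveI : SecondCountableTopology G :=
    (r.continuous.isClosedEmbedding r.injective).isEmbedding.secondCountableTopology
  obtain ⟨m, hm⟩ := strongDecaySeq_of_torusGap r b hk hB
  exact ⟨r, b, m, hb, hm⟩

/-- **The line with the route's item in place of stub B**: stub T (by name) and crux 4
`TorusToStrong` (stmt-QuantumFields-10415, a registered obligation, by name) give the crux. [glue] -/
theorem StrongGapSeqAllG_of_torusToStrong (h : TorusToStrong) : StrongGapSeqAllG :=
  StrongGapSeqAllG_of_hypotheses stub_torusGapSeq (torusToStrongRate_of_torusToStrong h)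

/-- Signature match: the registered composition has literally the route's crux as its type. -/
example : Summit.QuantumFields.YangMills.Theses.ThermalRuler.StrongGapSeqAllG :=
  StrongGapSeqAllG_of

end Summit.QuantumFields.YangMills.Cruxes.StrongGapSeqAllG.Birth

end
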